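import Literature.NumberTheory.EllipticCurves.GrossZagierRationalPointProofs
import Literature.NumberTheory.EllipticCurves.BSDSelmerPConverse
import Literature.NumberTheory.QuadraticFields.KroneckerSplitting
import HarnessLib

/-!
# Gross–Zagier 1986, Thm. I.(7.3) over `ℚ` from the tree's primary facts — the FRIEDBERG–HOFFSTEIN variant

Proofs-only companion (theorems only: no definition, no named fact, nothing restated) of
`GrossZagierRationalPointProofs.lean`. That file discharges the composite named fact
`GrossZagier1986_thm_I_7_3` from three primary prints: modularity in the parametrisation form
(`ModularForms.nonempty_modularParametrizationData`), Hoffstein–Luo 1997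
(`HoffsteinLuo1997_exists_twist_L_one_ne_zero`, the supplier of Waldspurger's non-vanishing twist with an
odd Heegner discriminant) and the Gross–Zagier formula over `K` (`gross_zagier`). THIS FILE runs the SAME
descent with the non-vanishing input replaced by the tree's Friedberg–Hoffstein fact
`friedbergHoffstein_exists_heegnerField_split_twist_ne_zero` (`BSDSelmerPConverse.lean`): for `w(E) = −1`
and the auxiliary prime `p = 2` it yields an imaginary quadratic Heegner field `K` for `N(E)` in which `2`
SPLITS — hence `d_K ≡ 1 (mod 8)`, odd (`Quadratic.ncard_primesOver_two_eq_two_iff`) — with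
`L(E^{(d_K)}, 1) ≠ 0`; nothing else of the Hoffstein–Luo shape (`≤ 4` prime factors) is used by the descent.
Consumer: the `p = 2` print line «disegni-pair-two» of crux stmt-BirchSwinnertonDyer-20368 (cell
`bsd-print-cf2`), whose print stubs already carry `nonempty_modularParametrizationData`, the
Friedberg–Hoffstein fact and `gross_zagier`, so that `GrossZagier1986_thm_I_7_3` leaves its print ledger.

* `GrossZagier1986_thm_I_7_3_main_of_isGloballyMinimal_of_friedbergHoffstein` — the `ℚ`-descent of
  GZ86 V.§2 for a globally minimal model (verbatim the Hoffstein–Luo version, step (2) replaced);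
* `GrossZagier1986_thm_I_7_3_main_of_deriv_ne_zero_of_friedbergHoffstein` — any model;
* `GrossZagier1986_thm_I_7_3_of_friedbergHoffstein` — the named fact from
  `nonempty_modularParametrizationData`, Friedberg–Hoffstein and `gross_zagier`.

References: [GrossZagier1986] B. H. Gross, D. B. Zagier, Invent. Math. 84 (1986), Thm. I.(7.3) (p. 231),
Thm. V.(2.1), V.§2 (pp. 312–313); [FriedbergHoffstein1995] S. Friedberg, J. Hoffstein, Ann. of Math. 142
(1995), main theorem; [BCDTJAMS2001] Thm. A; [CaiShuTian2014] Thm. 1.1.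
-/

noncomputable section

open scoped Classical MatrixGroups ModularForm NumberTheorySymbols

open Complex CongruenceSubgroup WeierstrassCurve NumberField

namespace Literature.NumberTheory.EllipticCurves

open ModularForms QuadraticFields

/-! ### §1 The descent for a globally minimal model (Gross–Zagier 1986, V.§2) with Friedberg–Hoffstein -/

section Minimal

/-- `√(|d|) = √|d|`. [folklore] -/
private theorem sqrt_natAbs_eq' (d : ℤ) : Real.sqrt (d.natAbs : ℝ) = Real.sqrt |(d : ℝ)| := by
  congr 1
  rw [Nat.cast_natAbs, Int.cast_abs]

/-- **Gross–Zagier 1986, Thm. I.(7.3), main clause, for a globally minimal model with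
`L(E,1) = 0 ≠ L'(E,1)`, Friedberg–Hoffstein variant**: as `GrossZagier1986_thm_I_7_3_main_of_isGloballyMinimal`
with the Heegner field `K` (`2` split, so `d_K ≡ 1 (mod 8)` is odd; every `ℓ ∣ N(E)` split; `L(E^{(d_K)},1) ≠ 0`)
taken from `friedbergHoffstein_exists_heegnerField_split_twist_ne_zero` at `w(E) = −1`, `p = 2`. Then verbatim:
product rule `L'(E/K,1) = L'(E,1)·L(E^{(d)},1)`, GZ86 Thm. V.(2.1), Birch's formula for the odd twist,
`cΩ⁻_f = k|Ω⁻(W)|`, Darmon Prop. 3.11, `ĥ_ℚ(P_K + P̄_K) = 2ĥ_K(P_K)`.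
[cite: GrossZagier1986, Thm. I.(7.3) (p. 231); V.§2 (pp. 312–313)] [cite: FriedbergHoffstein1995, main theorem] -/
theorem GrossZagier1986_thm_I_7_3_main_of_isGloballyMinimal_of_friedbergHoffstein
    (hmodP : nonempty_modularParametrizationData)
    (hFH : friedbergHoffstein_exists_heegnerField_split_twist_ne_zero)
    (hGZ : ∀ (N : ℕ) [NeZero N] (W : WeierstrassCurve ℚ) (K : Type) [Field K] [NumberField K],
      gross_zagier N W K)
    (W : WeierstrassCurve ℚ) [W.IsElliptic] [W.IsGloballyMinimal] (h0 : W.entireLFunction 1 = 0)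
    (h1 : deriv W.entireLFunction 1 ≠ 0) :
    ∃ (P : W.toAffine.Point) (α : ℚ), α ≠ 0 ∧
      deriv W.entireLFunction 1 = (((α : ℝ) * W.realPeriodRat * P.canonicalHeight : ℝ) : ℂ) := by
  haveI hN : NeZero (W.conductorNorm ℤ) := ⟨(W.conductorNorm_pos_holds).ne'⟩
  have hmod : exists_isNewformOf := exists_isNewformOf_of_nonempty_modularParametrizationData hmodP
  have hE : hasEntireLFunction_rat := hasEntireLFunction_rat_of_exists_isNewformOf hmod
  -- (1) analytic rank one and `w(E) = -1`
  have hr : W.analyticRank = 1 := by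
    have hne := analyticRank_ne_zero_of_entireLFunction_one_eq_zero W (hE W) h0
    exact (analyticOrderNatAt_eq_one_iff_deriv_ne_zero (Nat.one_le_iff_ne_zero.mpr hne)).2 h1
  have hw : W.rootNumber = -1 := by
    rcases W.rootNumber_eq_one_or with hw | hw
    · exact absurd ((even_analyticRank_iff_of_exists_isNewformOf hmod W).mpr hw)
        (by rw [hr]; exact Nat.not_even_one)
    · exact hw
  -- (2) a Heegner field with odd discriminant and `L(E^{(d_K)}, 1) ≠ 0`
  obtain ⟨K, _, _, hKq, -, hH, hH2, hLt⟩ := hFH W hw 2 Nat.prime_two 0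
  have hodd : Odd (NumberField.discr K) := by
    have h8 : NumberField.discr K % 8 = 1 :=
      (Quadratic.ncard_primesOver_two_eq_two_iff hKq.1).mp (hH2 2 Nat.prime_two (dvd_refl 2))
    exact Int.odd_iff.mpr (by omega)
  set d : ℤ := NumberField.discr K with hd
  have hdneg : d < 0 := IsImaginaryQuadratic.discr_neg hKq
  have hd4sq : d % 4 = 1 ∧ Squarefree d := by
    rcases QuadraticFields.Quadratic.isFundamentalDiscriminant_discr hKq.1 with ⟨h4, hsq, -⟩ | ⟨h4, -, -⟩
    · exact ⟨h4, hsq⟩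
    · exfalso
      exact (Int.not_even_iff_odd.mpr hodd) (even_iff_two_dvd.mpr (dvd_trans ⟨2, by norm_num⟩ h4))
  have hkr := (satisfiesHeegnerHypothesis_iff_kronecker (W.conductorNorm ℤ) K hKq.1).mp hH
  have hgcd : Int.gcd d (W.conductorNorm ℤ) = 1 :=
    int_gcd_eq_one_of_forall_jacobiSym_eq_one (by omega) fun p hp hpN hp2 ↦ (hkr p hp hpN).2 hp2
  have hdq : (d : ℚ) ≠ 0 := by exact_mod_cast hdneg.ne
  haveI := W.isElliptic_quadraticTwist hdq
  -- (3) the Heegner point, its parametrisation datum, and Gross–Zagier over `K`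
  obtain ⟨PK, Dt, Hd, ι, hι⟩ :=
    exists_isHeegnerPoint_of_nonempty_modularParametrizationData (W := W) (K := K) hmodP hKq hH
  have eGZ := hGZ _ W K hKq hH Dt Hd ι PK hι
  -- (4) the product rule `L'(E/K, 1) = L'(E, 1) · L(E^{(d)}, 1)`
  have hprod := lDerivEK_eq_deriv_mul_of_entireLFunction_one_eq_zero hE W K h0
  -- (5) Birch: `√|d| · L(E^{(d)}, 1) = s · Ω⁻_f`
  obtain ⟨s, hs⟩ := exists_rat_sqrt_mul_entireLFunction_quadraticTwist_one_eq hE W Dt.isNewformOf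
    hdneg hd4sq.2 hd4sq.1 hgcd
  rw [sqrt_natAbs_eq'] at hs
  -- (6) periods: `c · Ω⁻_f = k · |Ω⁻(W)|`, `Ω · |Ω⁻| = 2 covol`
  obtain ⟨k, hk0, hk⟩ := Dt.exists_int_maninConstant_mul_minusPeriod_eq
  have hcov := Dt.realPeriodRat_mul_imaginaryPeriodRat_eq_two_mul_covolume
  -- (7) Darmon's Prop. 3.11 and the descended point `P = P_K + P̄_K`
  obtain ⟨θ, cθ, hθ, hcθ⟩ :=
    Literature.NumberTheory.QuadraticFields.Quadratic.exists_sq_eq_algebraMap (F := ℚ) (K := K) hKq.1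
  have hσ : Literature.NumberTheory.QuadraticFields.Quadratic.conj hKq.1 hθ hcθ ≠ AlgHom.id ℚ K := by
    intro hid
    have h1' : Literature.NumberTheory.QuadraticFields.Quadratic.conj hKq.1 hθ hcθ θ = -θ :=
      Literature.NumberTheory.QuadraticFields.Quadratic.conj_gen hKq.1 hθ hcθ
    rw [hid, AlgHom.id_apply] at h1'
    have h2θ : (2 : K) * θ = 0 := by linear_combination h1'
    exact Literature.NumberTheory.QuadraticFields.Quadratic.ne_zero_of_not_mem_range hθ
      ((mul_eq_zero.mp h2θ).resolve_left two_ne_zero)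
  have hT := heegnerPoint_conj_add_rootNumber_smul_holds W K hKq hH ⟨Dt, Hd, ι, hι⟩ _ hσ
  rw [hw, neg_one_zsmul, ← sub_eq_add_neg] at hT
  obtain ⟨R, hR⟩ := exists_point_canonicalHeight_eq_two_mul W hKq.1 hσ hT
  -- (8) bookkeeping
  have hc : (Dt.c : ℝ) ≠ 0 := Int.cast_ne_zero.mpr Dt.maninConstant_ne_zero_holds
  have hu : (0 : ℝ) < Units.torsionOrder K := by exact_mod_cast Units.torsionOrder_pos K
  have hsD : 0 < Real.sqrt |(d : ℝ)| := Real.sqrt_pos.mpr (abs_pos.mpr (by exact_mod_cast hdneg.ne))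
  have hΩm : 0 < W.imaginaryPeriodRat := W.imaginaryPeriodRat_pos
  have hΩf : 0 < minusPeriod Dt.f :=
    IsNewform0.minusPeriod_pos_holds Dt.isNewformOf.1 Dt.isNewformOf.coeffField_eq_bot
  have hkR : (k : ℝ) ≠ 0 := Int.cast_ne_zero.mpr hk0
  have hs0 : s ≠ 0 := by
    rintro rfl
    rw [Rat.cast_zero, zero_mul, mul_eq_zero] at hs
    rcases hs with h | h
    · exact hsD.ne' (by exact_mod_cast h)
    · exact hLt h
  have hsR : (s : ℝ) ≠ 0 := Rat.cast_ne_zero.mpr hs0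
  -- `L(E^{(d)}, 1) = s Ω⁻_f / √|d|` and `L'(E, 1) = (GZ constant · ĥ_K(P_K)) / L(E^{(d)}, 1)`
  have hLd : (W.quadraticTwist (d : ℚ)).entireLFunction 1 =
      (((s : ℝ) * minusPeriod Dt.f / Real.sqrt |(d : ℝ)| : ℝ) : ℂ) := by
    have hsDC : (Real.sqrt |(d : ℝ)| : ℂ) ≠ 0 := Complex.ofReal_ne_zero.mpr hsD.ne'
    rw [Complex.ofReal_div, eq_div_iff hsDC]
    push_cast
    linear_combination hs
  have hL' : deriv W.entireLFunction 1 =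
      (((2 * ZLattice.covolume Dt.L.lattice /
          ((Dt.c : ℝ) ^ 2 * ((Units.torsionOrder K : ℝ) / 2) ^ 2 * Real.sqrt |(d : ℝ)|) *
          PK.canonicalHeight) / ((s : ℝ) * minusPeriod Dt.f / Real.sqrt |(d : ℝ)|) : ℝ) : ℂ) := by
    rw [Complex.ofReal_div, ← hLd, ← eGZ, hprod, mul_div_cancel_right₀ _ hLt]
  refine ⟨R, 1 / (2 * (Dt.c : ℚ) * ((Units.torsionOrder K : ℚ) / 2) ^ 2 * s * k), ?_, ?_⟩
  · have hcQ : (Dt.c : ℚ) ≠ 0 := Int.cast_ne_zero.mpr Dt.maninConstant_ne_zero_holds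
    have huQ : (Units.torsionOrder K : ℚ) / 2 ≠ 0 :=
      div_ne_zero (by exact_mod_cast (Units.torsionOrder_pos K).ne') two_ne_zero
    have hkQ : (k : ℚ) ≠ 0 := Int.cast_ne_zero.mpr hk0
    exact one_div_ne_zero (mul_ne_zero (mul_ne_zero (mul_ne_zero (mul_ne_zero two_ne_zero hcQ)
      (pow_ne_zero 2 huQ)) hs0) hkQ)
  · rw [hL', Complex.ofReal_inj]
    have hΩf' : minusPeriod Dt.f = k * W.imaginaryPeriodRat / Dt.c := by
      rw [eq_div_iff hc]; linarith [hk]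
    have hcov' : ZLattice.covolume Dt.L.lattice = W.realPeriodRat * W.imaginaryPeriodRat / 2 := by
      linarith [hcov]
    rw [hR, hΩf', hcov']
    push_cast
    field_simp

end Minimal

/-! ### §2 Any model, the regulator clause, and the named fact -/

section Assembly

open WeierstrassCurve.Affine.Point

/-- **Gross–Zagier 1986, Thm. I.(7.3), main clause with `L'(E,1) ≠ 0`, ANY model, Friedberg–Hoffstein variant**:
transported from a globally minimal model `C • W` (`hasGlobalMinimalModel_rat_holds`) by the invariance of
`L(E, s)`, `Ω(C • W) = |u| Ω(W)` and `ĥ(φ P) = ĥ(P)`. [cite: GrossZagier1986, Thm. I.(7.3) (p. 231); V.§2 (pp. 312–313)] -/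
theorem GrossZagier1986_thm_I_7_3_main_of_deriv_ne_zero_of_friedbergHoffstein
    (hmodP : nonempty_modularParametrizationData)
    (hFH : friedbergHoffstein_exists_heegnerField_split_twist_ne_zero)
    (hGZ : ∀ (N : ℕ) [NeZero N] (W : WeierstrassCurve ℚ) (K : Type) [Field K] [NumberField K],
      gross_zagier N W K)
    (W : WeierstrassCurve ℚ) [W.IsElliptic] (h0 : W.entireLFunction 1 = 0)
    (h1 : deriv W.entireLFunction 1 ≠ 0) :
    ∃ (P : W.toAffine.Point) (α : ℚ), α ≠ 0 ∧
      deriv W.entireLFunction 1 = (((α : ℝ) * W.realPeriodRat * P.canonicalHeight : ℝ) : ℂ) := by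
  obtain ⟨C, hC⟩ := hasGlobalMinimalModel_rat_holds W
  haveI := hC
  have hL : (C • W).entireLFunction = W.entireLFunction := WeierstrassCurve.entireLFunction_smul W C
  obtain ⟨P', α, hα, he⟩ := GrossZagier1986_thm_I_7_3_main_of_isGloballyMinimal_of_friedbergHoffstein hmodP hFH hGZ
    (C • W) (by rw [hL]; exact h0) (by rw [hL]; exact h1)
  rw [hL, W.realPeriodRat_smul_holds C] at he
  obtain ⟨P, rfl⟩ := (VariableChange.pointEquiv W C).surjective P'
  -- (`convert`: the `DecidableEq ℚ` instances hidden in the two point groups differ syntactically)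
  have hh : canonicalHeight (VariableChange.pointEquiv W C P) = canonicalHeight P := by
    convert canonicalHeight_pointEquiv (W := W) C P
  refine ⟨P, α * |(C.u : ℚ)|, mul_ne_zero hα (abs_ne_zero.mpr C.u.ne_zero), ?_⟩
  rw [he, hh]
  push_cast
  ring

/-- **Gross–Zagier 1986, Thm. I.(7.3) from `nonempty_modularParametrizationData`, Friedberg–Hoffstein and
`gross_zagier`** — the composite named fact `GrossZagier1986_thm_I_7_3` DISCHARGED modulo these three primary
prints (cases `L'(E,1) = 0`: `P = O`, `α = 1`; `L'(E,1) ≠ 0`: the main clause; clause 2): `ĥ(P) = n²·Reg` in rank one).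
[cite: GrossZagier1986, Thm. I.(7.3) (p. 231); proof V.§2 (pp. 310–313)] [cite: FriedbergHoffstein1995, main theorem] -/
theorem GrossZagier1986_thm_I_7_3_of_friedbergHoffstein
    (hmodP : nonempty_modularParametrizationData)
    (hFH : friedbergHoffstein_exists_heegnerField_split_twist_ne_zero)
    (hGZ : ∀ (N : ℕ) [NeZero N] (W : WeierstrassCurve ℚ) (K : Type) [Field K] [NumberField K],
      gross_zagier N W K) :
    GrossZagier1986_thm_I_7_3 := by
  intro W _ h0
  by_cases h1 : deriv W.entireLFunction 1 = 0
  · refine ⟨⟨0, 1, one_ne_zero, ?_⟩, fun h ↦ absurd h1 h⟩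
    rw [h1, canonicalHeight_zero, mul_zero, Complex.ofReal_zero]
  obtain ⟨P, α, hα, he⟩ := GrossZagier1986_thm_I_7_3_main_of_deriv_ne_zero_of_friedbergHoffstein hmodP hFH hGZ W h0 h1
  refine ⟨⟨P, α, hα, he⟩, fun _ hrk ↦ ?_⟩
  obtain ⟨n, hn⟩ := exists_int_canonicalHeight_eq_sq_mul_regulator W hrk P
  have hn0 : n ≠ 0 := by
    rintro rfl
    apply h1
    rw [he, hn]
    simp
  refine ⟨α * (n : ℚ) ^ 2, mul_ne_zero hα (pow_ne_zero 2 (Int.cast_ne_zero.mpr hn0)), ?_⟩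
  rw [he, hn]
  push_cast
  ring

end Assembly

end Literature.NumberTheory.EllipticCurves

end
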